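import Summits.CriticalPhenomena.CardyFormulaZ2.Theorems.CardyBoundaryCoulombGasHalfPlaneMarkDensityLawDensityRegularity
import Summits.CriticalPhenomena.CardyFormulaZ2.Theorems.CardyBoundaryCoulombGasHalfPlaneMarkDensityLawIdentification
import Summits.CriticalPhenomena.CardyFormulaZ2.Theorems.CardyBoundaryCoulombGasHalfPlaneMarkDensityLawSymmetry

/-!
# `HalfPlaneMarkDensityLaw` (crux stmt-CriticalPhenomena-5661), line `Sketch`:
# joint subsequential limits are `C¹` in the fourth mark, with derivative the density limit;
# the crux is the identification of that derivative (lead c4-0)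

`P_n(a,b,c,y) = P_{1/2}[[⌊an⌋,⌊bn⌋]×{0} ↔ [⌊cn⌋,⌊yn⌋]×{0} in ℤ×ℕ]` (CDF),
`lawSeq a b c x n = n · P_{1/2}[E_n(a,b,c,x)]` (the crux's sequence, the lattice mark density).
For every joint subsequential limit `G` of `P_n` along a strictly increasing `θ`
(`…SubsequentialLimits`: they exist along a subsequence of every subsequence) and every chamber point
`a < b < c < x`:

* `hasDerivAt_jointLimit` — `y ↦ G a b c y` is differentiable at `x` AND the crux's sequence converges
  along `θ` to its derivative: `lawSeq a b c x (θ j) → ∂₄G(a,b,c,x)`; `0 ≤ ∂₄G`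
  (`deriv_jointLimit_nonneg`); `∂₄G(a,b,c,·)` is locally Lipschitz on `(c,∞)` with second-order Taylor
  bounds (`taylor_jointLimit`), hence continuous (`continuousOn_deriv_jointLimit`): every joint limit
  is `C^{1,1}` in the fourth mark (`differentiableOn_jointLimit` + `continuousOn_deriv_jointLimit`),
  and by the exact lattice reflection also differentiable in the FIRST mark
  (`hasDerivAt_jointLimit_first`: `∂₁G(a,b,c,y) = −∂₄G(−y,−c,−b,−a)`);
* `exists_jointLimit_of_tendsto_lawSeq` — conversely every subsequential limit `L` of the crux's
  sequence is `∂₄G(a,b,c,x)` for some joint limit `G`: the subsequential limits of the lattice mark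
  density are EXACTLY the fourth-mark derivatives of the joint subsequential crossing limits;
* `halfPlaneMarkDensityLaw_iff_derivIdentification` (registered extra stub `stub_derivIdentification`)
  — **the crux ⟺ for every joint subsequential limit `G`, `∂₄G(a,b,c,x) = F′(η)∂ₓη`** (Cardy's density)
  on the chamber.  Compare `halfPlaneMarkDensityLaw_iff_jointLimits` (c2-0: crux ⟺ `G = F∘η`): the
  density form of the crux carries no lattice-scale content even subsequence by subsequence — the
  pointwise law and its window-averaged form agree along every CDF-convergent subsequence.
-/

noncomputable section

namespace Summit.CriticalPhenomena.CardyFormulaZ2.Cruxes.HalfPlaneMarkDensityLaw.SketchLine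

open Literature.Probability.Percolation Literature.Probability.LatticeModels
open MeasureTheory Filter Set
open scoped Topology
open Summit.CriticalPhenomena.CardyFormulaZ2.Theses.CardyBoundaryCoulombGas (HalfPlaneMarkDensityLaw)
open Summit.CriticalPhenomena.CardyFormulaZ2.Theorems.HalfPlaneMarkDensityLaw.Negative

namespace Density

/-! ### Every joint subsequential limit is `C¹` in the fourth mark; its derivative is the density limit -/

section JointLimit

variable {θ : ℕ → ℕ} {G : ℝ → ℝ → ℝ → ℝ → ℝ}
  (hG : ∀ a b c y : ℝ, a < b → b < c → c < y →
    Tendsto (fun n ↦ μ.real (openCrossing halfPlane (arcA a b (θ n))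
      (rowIcc ⌊c * (θ n : ℕ)⌋ ⌊y * (θ n : ℕ)⌋))) atTop (𝓝 (G a b c y)))
include hG

/-- **Joint limits are differentiable in the fourth mark, with derivative the density limit.** For a
joint subsequential limit `G` along `θ → ∞` and `a < b < c < x`: `y ↦ G a b c y` is differentiable at
`x`, and the crux's sequence converges ALONG `θ` to `∂₄G(a,b,c,x)`. [folklore] -/
theorem hasDerivAt_jointLimit (hθ : Tendsto θ atTop atTop) {a b c x : ℝ} (hab : a < b) (hbc : b < c)
    (hcx : c < x) :
    HasDerivAt (G a b c) (deriv (G a b c) x) x ∧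
      Tendsto (fun j ↦ lawSeq a b c x (θ j)) atTop (𝓝 (deriv (G a b c) x)) := by
  have hδ₀ : 0 < (x - c) / 2 := by linarith
  have hcx' : c < x - (x - c) / 2 := by linarith
  obtain ⟨ρ, hρ, hD⟩ := tendsto_lawSeq_and_hasDerivAt hab hbc hδ₀ hcx' hθ (G := G a b c)
    (fun y hy _ ↦ hG a b c y hab hbc (by linarith))
  rw [hD.deriv]
  exact ⟨hD, hρ⟩

/-- Joint limits are differentiable on `(c, ∞)` in the fourth mark. [folklore] -/
theorem differentiableOn_jointLimit (hθ : Tendsto θ atTop atTop) {a b c : ℝ} (hab : a < b)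
    (hbc : b < c) : DifferentiableOn ℝ (G a b c) (Ioi c) :=
  fun _ hx ↦ (hasDerivAt_jointLimit hG hθ hab hbc hx).1.differentiableAt.differentiableWithinAt

/-- The fourth-mark derivative of a joint limit is nonnegative. [folklore] -/
theorem deriv_jointLimit_nonneg (hθ : Tendsto θ atTop atTop) {a b c x : ℝ} (hab : a < b) (hbc : b < c)
    (hcx : c < x) : 0 ≤ deriv (G a b c) x :=
  ge_of_tendsto' (hasDerivAt_jointLimit hG hθ hab hbc hcx).2 fun j ↦ lawSeq_nonneg a b c x (θ j)

/-- **`C^{1,1}` in the fourth mark, quantitatively.** On `[x₀, x₁] ⊂ (c,∞)` there is `C ≥ 0` with the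
second-order Taylor bounds `|G(x+t) − G(x) − ∂₄G(x)·t| ≤ Ct²`, `|G(x) − G(x−t) − ∂₄G(x)·t| ≤ Ct²`
(`(x−δ₀, x+δ₀) ⊆ [x₀,x₁]`, `0 < t < δ₀`) and the Lipschitz bound
`|∂₄G(x') − ∂₄G(x)| ≤ C|x' − x|` for `x, x' ∈ [x₀, x₁]`. [folklore] -/
theorem taylor_jointLimit (hθ : Tendsto θ atTop atTop) {a b c x₀ x₁ : ℝ} (hab : a < b) (hbc : b < c)
    (hcx₀ : c < x₀) (hx₀₁ : x₀ ≤ x₁) :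
    ∃ C : ℝ, 0 ≤ C ∧
      (∀ (x δ₀ : ℝ), 0 < δ₀ → x₀ ≤ x - δ₀ → x + δ₀ ≤ x₁ → ∀ t : ℝ, 0 < t → t < δ₀ →
        |G a b c (x + t) - G a b c x - deriv (G a b c) x * t| ≤ C * t ^ 2 ∧
        |G a b c x - G a b c (x - t) - deriv (G a b c) x * t| ≤ C * t ^ 2) ∧
      (∀ x ∈ Icc x₀ x₁, ∀ x' ∈ Icc x₀ x₁,
        |deriv (G a b c) x' - deriv (G a b c) x| ≤ C * |x' - x|) := by
  obtain ⟨C, hC0, hT, hL⟩ := densityRegularity hab hbc hcx₀ hx₀₁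
  refine ⟨C, hC0, fun x δ₀ hδ₀ hlo hhi t ht htδ ↦ ?_, fun x hx x' hx' ↦ ?_⟩
  · obtain ⟨ρ, -, hD, hR, hL'⟩ := hT x δ₀ hδ₀ hlo hhi θ hθ (G a b c)
      (fun y hy _ ↦ hG a b c y hab hbc (by linarith))
    rw [hD.deriv]
    exact ⟨hR t ht htδ, hL' t ht htδ⟩
  · exact hL θ hθ x x' _ _ hx.1 hx.2 hx'.1 hx'.2
      (hasDerivAt_jointLimit hG hθ hab hbc (hcx₀.trans_le hx.1)).2
      (hasDerivAt_jointLimit hG hθ hab hbc (hcx₀.trans_le hx'.1)).2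

/-- The fourth-mark derivative of a joint limit is continuous on `(c, ∞)`: joint limits are `C¹` in
the fourth mark. [folklore] -/
theorem continuousOn_deriv_jointLimit (hθ : Tendsto θ atTop atTop) {a b c : ℝ} (hab : a < b)
    (hbc : b < c) : ContinuousOn (deriv (G a b c)) (Ioi c) := by
  rw [Metric.continuousOn_iff]
  intro x hx ε hε
  have hcx : c < x := hx
  obtain ⟨C, hC0, -, hL⟩ := taylor_jointLimit hG hθ hab hbc (by linarith : c < (c + x) / 2)
    (by linarith : (c + x) / 2 ≤ x + (x - c) / 2)
  refine ⟨min ((x - c) / 2) (ε / (C + 1)), lt_min (by linarith) (by positivity), fun x' hx' hd ↦ ?_⟩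
  have hd1 : dist x' x < (x - c) / 2 := hd.trans_le (min_le_left _ _)
  have hd2 : dist x' x < ε / (C + 1) := hd.trans_le (min_le_right _ _)
  rw [Real.dist_eq] at hd1 hd2 ⊢
  have hx'I : x' ∈ Icc ((c + x) / 2) (x + (x - c) / 2) := by
    rw [abs_lt] at hd1; constructor <;> linarith
  have hxI : x ∈ Icc ((c + x) / 2) (x + (x - c) / 2) := by constructor <;> linarith
  refine (hL x hxI x' hx'I).trans_lt ?_
  calc C * |x' - x| ≤ C * (ε / (C + 1)) := mul_le_mul_of_nonneg_left hd2.le hC0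
    _ < ε := by
      rw [mul_div_assoc', div_lt_iff₀ (by positivity)]
      nlinarith

/-- **`C¹` in the first mark, by reflection.** For a joint limit along a strictly increasing `θ`
and `a < b < c < y`, `s ↦ G s b c y` is differentiable at `a` with derivative `−∂₄G(−y,−c,−b,−a)`,
the (negative of the) limit along `θ` of the crux's sequence at the reflected marks: the exact lattice
reflection `v₀ ↦ −v₀` exchanges the roles of the first and fourth marks
(`reflect_of_jointLimit`: `G(−y,−c,−b,−a) = G(a,b,c,y)`). [folklore] -/
theorem hasDerivAt_jointLimit_first (hθ : StrictMono θ) {a b c y : ℝ} (hab : a < b) (hbc : b < c)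
    (hcy : c < y) :
    HasDerivAt (fun s ↦ G s b c y) (-deriv (G (-y) (-c) (-b)) (-a)) a ∧
      Tendsto (fun j ↦ lawSeq (-y) (-c) (-b) (-a) (θ j)) atTop
        (𝓝 (deriv (G (-y) (-c) (-b)) (-a))) := by
  have h := hasDerivAt_jointLimit hG hθ.tendsto_atTop (a := -y) (b := -c) (c := -b) (x := -a)
    (by linarith) (by linarith) (by linarith)
  refine ⟨?_, h.2⟩
  have hcomp : HasDerivAt (fun s ↦ G (-y) (-c) (-b) (-s)) (deriv (G (-y) (-c) (-b)) (-a) * (-1)) a :=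
    h.1.comp a (hasDerivAt_neg a)
  have hev : (fun s ↦ G (-y) (-c) (-b) (-s)) =ᶠ[𝓝 a] fun s ↦ G s b c y := by
    filter_upwards [Iio_mem_nhds hab] with s hs
    exact Subseq.reflect_of_jointLimit hG hθ hs hbc hcy
  rw [show -deriv (G (-y) (-c) (-b)) (-a) = deriv (G (-y) (-c) (-b)) (-a) * (-1) by ring]
  exact hcomp.congr_of_eventuallyEq hev.symm

/-- Joint limits are differentiable on `(−∞, b)` in the first mark. [folklore] -/
theorem differentiableOn_jointLimit_first (hθ : StrictMono θ) {b c y : ℝ} (hbc : b < c) (hcy : c < y) :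
    DifferentiableOn ℝ (fun s ↦ G s b c y) (Iio b) :=
  fun _ hs ↦ (hasDerivAt_jointLimit_first hG hθ hs hbc hcy).1.differentiableAt.differentiableWithinAt

end JointLimit

/-! ### The subsequential limits of the mark density are exactly the derivatives of joint limits -/

/-- **Every subsequential limit of the crux's sequence is the fourth-mark derivative of a joint
subsequential limit.** If `lawSeq a b c x (φ j) → L` along a strictly increasing `φ`, then along a
further subsequence `φ ∘ ψ` the CDF has a joint limit `G` on the chamber, and `∂₄G(a,b,c,x) = L`.
[folklore] -/
theorem exists_jointLimit_of_tendsto_lawSeq {a b c x L : ℝ} (hab : a < b) (hbc : b < c) (hcx : c < x)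
    {φ : ℕ → ℕ} (hφ : StrictMono φ) (hL : Tendsto (fun j ↦ lawSeq a b c x (φ j)) atTop (𝓝 L)) :
    ∃ ψ : ℕ → ℕ, StrictMono ψ ∧ ∃ G : ℝ → ℝ → ℝ → ℝ → ℝ,
      (∀ a' b' c' y : ℝ, a' < b' → b' < c' → c' < y →
        Tendsto (fun n ↦ μ.real (openCrossing halfPlane (arcA a' b' (φ (ψ n)))
          (rowIcc ⌊c' * (φ (ψ n) : ℕ)⌋ ⌊y * (φ (ψ n) : ℕ)⌋))) atTop (𝓝 (G a' b' c' y))) ∧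
      HasDerivAt (G a b c) L x := by
  obtain ⟨ψ, hψ, G, hG⟩ := Subseq.exists_jointSubseqLimit φ hφ
  refine ⟨ψ, hψ, G, hG, ?_⟩
  have h := hasDerivAt_jointLimit (θ := fun n ↦ φ (ψ n)) hG (hφ.comp hψ).tendsto_atTop hab hbc hcx
  have h2 : Tendsto (fun j ↦ lawSeq a b c x (φ (ψ j))) atTop (𝓝 L) := hL.comp hψ.tendsto_atTop
  rw [← tendsto_nhds_unique h.2 h2]
  exact h.1

/-! ### The crux is the identification of the fourth-mark derivative of the joint limits -/

/-- **The crux ⟺ derivative identification.** `HalfPlaneMarkDensityLaw` (by name) holds if and only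
if, for every joint subsequential limit `G` of the collinear half-plane crossing function of bond-`ℤ²`
(along every strictly increasing subsequence, at every chamber point simultaneously), the fourth-mark
derivative of `G` at every chamber point is Cardy's density
`(cardyConst/3)·((b−a)(c−b)(c−a))^{1/3}·((x−a)(x−b)(x−c))^{−2/3} = F′(η)∂ₓη`.
(`⟹`: c2-0's identification `G = F∘η` + the chain rule `hasDerivAt_cardy_crossRatio`;
`⟸`: precompactness of the CDF, `hasDerivAt_jointLimit`, uniqueness of derivatives and the
subsequence principle.) [folklore] -/
theorem halfPlaneMarkDensityLaw_iff_derivIdentification :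
    HalfPlaneMarkDensityLaw ↔
    ∀ θ : ℕ → ℕ, StrictMono θ → ∀ G : ℝ → ℝ → ℝ → ℝ → ℝ,
      (∀ a b c y : ℝ, a < b → b < c → c < y →
        Tendsto (fun n ↦ μ.real (openCrossing halfPlane (arcA a b (θ n))
          (rowIcc ⌊c * (θ n : ℕ)⌋ ⌊y * (θ n : ℕ)⌋))) atTop (𝓝 (G a b c y))) →
      ∀ a b c x : ℝ, a < b → b < c → c < x → HasDerivAt (G a b c) (density a b c x) x := by
  constructor
  · intro hlaw θ hθ G hG a b c x hab hbc hcx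
    have hId := (Subseq.halfPlaneMarkDensityLaw_iff_jointLimits.1 hlaw) θ hθ G hG
    refine (hasDerivAt_cardy_crossRatio hab hbc hcx).congr_of_eventuallyEq ?_
    filter_upwards [Ioi_mem_nhds hcx] with y hy
    exact hId a b c y hab hbc hy
  · intro hId
    rw [halfPlaneMarkDensityLaw_iff]
    intro a b c x hab hbc hcx
    refine tendsto_of_subseq_tendsto fun ns hns ↦ ?_
    obtain ⟨φ₁, -, hmono⟩ := strictMono_subseq_of_tendsto_atTop hns
    obtain ⟨ψ, hψ, G, hG⟩ := Subseq.exists_jointSubseqLimit (ns ∘ φ₁) hmono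
    refine ⟨φ₁ ∘ ψ, ?_⟩
    have h := hasDerivAt_jointLimit (θ := fun n ↦ (ns ∘ φ₁) (ψ n)) hG
      (hmono.comp hψ).tendsto_atTop hab hbc hcx
    have h' := hId (fun n ↦ (ns ∘ φ₁) (ψ n)) (hmono.comp hψ) G hG a b c x hab hbc hcx
    rw [← h.1.unique h']
    exact h.2

/-- **Registered extra stub of line `Sketch` (lead c4-0): the crux is the identification of the
fourth-mark derivative of the joint subsequential limits**, closed form of
`halfPlaneMarkDensityLaw_iff_derivIdentification`. [folklore] -/
theorem stub_derivIdentification :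
    HalfPlaneMarkDensityLaw ↔
    ∀ θ : ℕ → ℕ, StrictMono θ → ∀ G : ℝ → ℝ → ℝ → ℝ → ℝ,
      (∀ a b c y : ℝ, a < b → b < c → c < y →
        Tendsto (fun n ↦ μ.real (openCrossing halfPlane (arcA a b (θ n))
          (rowIcc ⌊c * (θ n : ℕ)⌋ ⌊y * (θ n : ℕ)⌋))) atTop (𝓝 (G a b c y))) →
      ∀ a b c x : ℝ, a < b → b < c → c < x → HasDerivAt (G a b c) (density a b c x) x :=
  halfPlaneMarkDensityLaw_iff_derivIdentification

end Density

end Summit.CriticalPhenomena.CardyFormulaZ2.Cruxes.HalfPlaneMarkDensityLaw.SketchLine
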